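import Summits.QuantumFields.YangMills.Theorems.ColdStartUniversalityLatticeLangevinCocyclePrep
import HarnessLib

/-!
# Route `ColdStartUniversality` (rung input (M), crux K_A1 stmt-QuantumFields-24809): the two legs of the splice —
# Itô integrals of the spliced integrand before the splicing time; the solution identity through Riemann–Itô sums

Helper file (seat `ym-line-csu-p1`, g4), for the splicing proof of the flow (cocycle) property on the canonical space
(regular flow `U` of `exists_regularFlow`, shift `θ_s`, splice `X` of `…LatticeLangevinSplice`):

* `measurable_flow_at`, `measurable_uncurry_flow`, `measurable_uncurry_flow_param` — adaptedness / joint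
  measurability consequences of the progressive measurability of `U`;
* `itoIntegral_splice_eq_firstLeg` — any Itô integrals `K` of the noise coefficients along the spliced process agree up to
  time `s` with the Itô integrals `J¹` along `U x` (common dyadic Riemann–Itô approximants, stopped u.c.p. uniqueness);
* `tendsto_measure_riemannIdentity` — for a fixed start `y`, the dyadic Riemann–Itô sums of the noise coefficients along
  `U y` converge in probability to `ρ(U y r)ᵢⱼ − ρ(y)ᵢⱼ − ∫₀ʳ bᵢⱼ(U y)` (real or imaginary part), i.e. the solution identity
  read through Riemann sums — the form that can be frozen at a random start.

No definition, no sorry.  RECORD-rung R3 plumbing; nothing here bears on the mass gap.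
-/

set_option autoImplicit false

noncomputable section

namespace Summit.QuantumFields.YangMills.Theorems.ColdStartUniversality

open MeasureTheory ProbabilityTheory Filter Topology Finset
open scoped NNReal ENNReal BigOperators
open Literature Literature.Probability.Process Literature.MathematicalPhysics.QuantumFieldTheory
open Literature.MathematicalPhysics.QuantumLattice (fundamentalRep fundamentalLatticeRep continuous_fundamentalRep)

variable {Ω : Type} [MeasurableSpace Ω] {P : Measure Ω} [IsProbabilityMeasure P] {L : ℕ} [NeZero L]
  {W : ℝ≥0 → Ω → (Edge 3 L × NoiseIdx 2 → ℝ)}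

/-! ## Measurability consequences of the progressive flow -/

/-- The flow at a fixed start and time is `𝓕_r`-measurable. [folklore] -/
theorem measurable_flow_at (hW : IsFlatBrownian W P)
    (U : GaugeConfig 3 L (Matrix.specialUnitaryGroup (Fin 2) ℂ) → ℝ≥0 →
      {p : ℝ≥0 → (Edge 3 L × NoiseIdx 2 → ℝ) // Continuous p ∧ p 0 = 0} →
      GaugeConfig 3 L (Matrix.specialUnitaryGroup (Fin 2) ℂ))
    (hprog : ∀ i : ℝ≥0, Measurable[@Prod.instMeasurableSpace (Set.Iic i)
        (GaugeConfig 3 L (Matrix.specialUnitaryGroup (Fin 2) ℂ) ×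
          {p : ℝ≥0 → (Edge 3 L × NoiseIdx 2 → ℝ) // Continuous p ∧ p 0 = 0}) inferInstance
        (@Prod.instMeasurableSpace (GaugeConfig 3 L (Matrix.specialUnitaryGroup (Fin 2) ℂ))
          {p : ℝ≥0 → (Edge 3 L × NoiseIdx 2 → ℝ) // Continuous p ∧ p 0 = 0} inferInstance
          ((isFlatBrownian_canonical hW).natFiltration i))]
      (fun q : Set.Iic i × (GaugeConfig 3 L (Matrix.specialUnitaryGroup (Fin 2) ℂ) ×
        {p : ℝ≥0 → (Edge 3 L × NoiseIdx 2 → ℝ) // Continuous p ∧ p 0 = 0}) => U q.2.1 q.1 q.2.2))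
    (y : GaugeConfig 3 L (Matrix.specialUnitaryGroup (Fin 2) ℂ)) (r : ℝ≥0) :
    Measurable[(isFlatBrownian_canonical hW).natFiltration r] (U y r) := by
  have hmap : @Measurable {p : ℝ≥0 → (Edge 3 L × NoiseIdx 2 → ℝ) // Continuous p ∧ p 0 = 0}
      (Set.Iic r × (GaugeConfig 3 L (Matrix.specialUnitaryGroup (Fin 2) ℂ) ×
        {p : ℝ≥0 → (Edge 3 L × NoiseIdx 2 → ℝ) // Continuous p ∧ p 0 = 0}))
      ((isFlatBrownian_canonical hW).natFiltration r)
      (@Prod.instMeasurableSpace _ _ inferInstance (@Prod.instMeasurableSpace _ _ inferInstance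
        ((isFlatBrownian_canonical hW).natFiltration r)))
      (fun p => ((⟨r, Set.mem_Iic.2 le_rfl⟩ : Set.Iic r), (y, p))) :=
    measurable_const.prodMk (measurable_const.prodMk measurable_id)
  have h := (hprog r).comp hmap
  exact h

/-- `(x, p) ↦ U x t p` is jointly measurable (ambient σ-algebras). [folklore] -/
theorem measurable_flow_pair (hW : IsFlatBrownian W P)
    (U : GaugeConfig 3 L (Matrix.specialUnitaryGroup (Fin 2) ℂ) → ℝ≥0 →
      {p : ℝ≥0 → (Edge 3 L × NoiseIdx 2 → ℝ) // Continuous p ∧ p 0 = 0} →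
      GaugeConfig 3 L (Matrix.specialUnitaryGroup (Fin 2) ℂ))
    (hprog : ∀ i : ℝ≥0, Measurable[@Prod.instMeasurableSpace (Set.Iic i)
        (GaugeConfig 3 L (Matrix.specialUnitaryGroup (Fin 2) ℂ) ×
          {p : ℝ≥0 → (Edge 3 L × NoiseIdx 2 → ℝ) // Continuous p ∧ p 0 = 0}) inferInstance
        (@Prod.instMeasurableSpace (GaugeConfig 3 L (Matrix.specialUnitaryGroup (Fin 2) ℂ))
          {p : ℝ≥0 → (Edge 3 L × NoiseIdx 2 → ℝ) // Continuous p ∧ p 0 = 0} inferInstance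
          ((isFlatBrownian_canonical hW).natFiltration i))]
      (fun q : Set.Iic i × (GaugeConfig 3 L (Matrix.specialUnitaryGroup (Fin 2) ℂ) ×
        {p : ℝ≥0 → (Edge 3 L × NoiseIdx 2 → ℝ) // Continuous p ∧ p 0 = 0}) => U q.2.1 q.1 q.2.2))
    (t : ℝ≥0) :
    Measurable fun q : GaugeConfig 3 L (Matrix.specialUnitaryGroup (Fin 2) ℂ) ×
      {p : ℝ≥0 → (Edge 3 L × NoiseIdx 2 → ℝ) // Continuous p ∧ p 0 = 0} => U q.1 t q.2 := by
  have h1 : Measurable[@Prod.instMeasurableSpace (Set.Iic t)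
      (GaugeConfig 3 L (Matrix.specialUnitaryGroup (Fin 2) ℂ) ×
        {p : ℝ≥0 → (Edge 3 L × NoiseIdx 2 → ℝ) // Continuous p ∧ p 0 = 0}) inferInstance inferInstance]
      (fun q : Set.Iic t × (GaugeConfig 3 L (Matrix.specialUnitaryGroup (Fin 2) ℂ) ×
        {p : ℝ≥0 → (Edge 3 L × NoiseIdx 2 → ℝ) // Continuous p ∧ p 0 = 0}) => U q.2.1 q.1 q.2.2) :=
    (hprog t).mono (sup_le_sup le_rfl (MeasurableSpace.comap_mono (sup_le_sup le_rfl
      (MeasurableSpace.comap_mono ((isFlatBrownian_canonical hW).natFiltration.le t))))) le_rfl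
  have h2 : Measurable fun q : GaugeConfig 3 L (Matrix.specialUnitaryGroup (Fin 2) ℂ) ×
      {p : ℝ≥0 → (Edge 3 L × NoiseIdx 2 → ℝ) // Continuous p ∧ p 0 = 0} =>
      ((⟨t, Set.mem_Iic.2 le_rfl⟩ : Set.Iic t), q) := measurable_const.prodMk measurable_id
  have h := h1.comp h2
  exact h

/-- `((x, p), u) ↦ U x u⁺ p` is jointly measurable in all three variables (ambient σ-algebras). [folklore] -/
theorem measurable_uncurry_flow_param (hW : IsFlatBrownian W P)
    (U : GaugeConfig 3 L (Matrix.specialUnitaryGroup (Fin 2) ℂ) → ℝ≥0 →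
      {p : ℝ≥0 → (Edge 3 L × NoiseIdx 2 → ℝ) // Continuous p ∧ p 0 = 0} →
      GaugeConfig 3 L (Matrix.specialUnitaryGroup (Fin 2) ℂ))
    (hprog : ∀ i : ℝ≥0, Measurable[@Prod.instMeasurableSpace (Set.Iic i)
        (GaugeConfig 3 L (Matrix.specialUnitaryGroup (Fin 2) ℂ) ×
          {p : ℝ≥0 → (Edge 3 L × NoiseIdx 2 → ℝ) // Continuous p ∧ p 0 = 0}) inferInstance
        (@Prod.instMeasurableSpace (GaugeConfig 3 L (Matrix.specialUnitaryGroup (Fin 2) ℂ))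
          {p : ℝ≥0 → (Edge 3 L × NoiseIdx 2 → ℝ) // Continuous p ∧ p 0 = 0} inferInstance
          ((isFlatBrownian_canonical hW).natFiltration i))]
      (fun q : Set.Iic i × (GaugeConfig 3 L (Matrix.specialUnitaryGroup (Fin 2) ℂ) ×
        {p : ℝ≥0 → (Edge 3 L × NoiseIdx 2 → ℝ) // Continuous p ∧ p 0 = 0}) => U q.2.1 q.1 q.2.2)) :
    Measurable fun q : (GaugeConfig 3 L (Matrix.specialUnitaryGroup (Fin 2) ℂ) ×
      {p : ℝ≥0 → (Edge 3 L × NoiseIdx 2 → ℝ) // Continuous p ∧ p 0 = 0}) × ℝ => U q.1.1 q.2.toNNReal q.1.2 := by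
  haveI := secondCountableTopology_su2
  haveI := borelSpace_config L
  exact measurable_uncurry_of_prog (Z := fun u (q : GaugeConfig 3 L (Matrix.specialUnitaryGroup (Fin 2) ℂ) ×
      {p : ℝ≥0 → (Edge 3 L × NoiseIdx 2 → ℝ) // Continuous p ∧ p 0 = 0}) => U q.1 u q.2)
    (fun n => @Prod.instMeasurableSpace _ _ inferInstance ((isFlatBrownian_canonical hW).natFiltration n))
    (fun n => sup_le_sup le_rfl (MeasurableSpace.comap_mono ((isFlatBrownian_canonical hW).natFiltration.le _)))
    (fun n => hprog n)

/-! ## The first leg: Itô integrals along the splice agree with those along `U x` up to time `s` -/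

/-- **Itô integrals of the noise coefficients along the spliced process agree with those along the first leg up to the
splicing time** (both are u.c.p. limits of the SAME dyadic Riemann–Itô sums there). [folklore] -/
theorem itoIntegral_splice_eq_firstLeg (hW : IsFlatBrownian W P) (β : ℝ)
    (U : GaugeConfig 3 L (Matrix.specialUnitaryGroup (Fin 2) ℂ) → ℝ≥0 →
      {p : ℝ≥0 → (Edge 3 L × NoiseIdx 2 → ℝ) // Continuous p ∧ p 0 = 0} →
      GaugeConfig 3 L (Matrix.specialUnitaryGroup (Fin 2) ℂ))
    (hU0 : ∀ y p, U y 0 p = y)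
    (hprog : ∀ i : ℝ≥0, Measurable[@Prod.instMeasurableSpace (Set.Iic i)
        (GaugeConfig 3 L (Matrix.specialUnitaryGroup (Fin 2) ℂ) ×
          {p : ℝ≥0 → (Edge 3 L × NoiseIdx 2 → ℝ) // Continuous p ∧ p 0 = 0}) inferInstance
        (@Prod.instMeasurableSpace (GaugeConfig 3 L (Matrix.specialUnitaryGroup (Fin 2) ℂ))
          {p : ℝ≥0 → (Edge 3 L × NoiseIdx 2 → ℝ) // Continuous p ∧ p 0 = 0} inferInstance
          ((isFlatBrownian_canonical hW).natFiltration i))]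
      (fun q : Set.Iic i × (GaugeConfig 3 L (Matrix.specialUnitaryGroup (Fin 2) ℂ) ×
        {p : ℝ≥0 → (Edge 3 L × NoiseIdx 2 → ℝ) // Continuous p ∧ p 0 = 0}) => U q.2.1 q.1 q.2.2))
    {G : Set (GaugeConfig 3 L (Matrix.specialUnitaryGroup (Fin 2) ℂ) ×
      {p : ℝ≥0 → (Edge 3 L × NoiseIdx 2 → ℝ) // Continuous p ∧ p 0 = 0})} (hGm : MeasurableSet G)
    (hGc : ∀ q ∈ G, Continuous fun r => U q.1 r q.2)
    (hGae : ∀ y, ∀ᵐ q ∂(P.map (fun ω => (⟨fun t => W t ω, continuous_path_and_zero hW ω⟩ :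
        {p : ℝ≥0 → (Edge 3 L × NoiseIdx 2 → ℝ) // Continuous p ∧ p 0 = 0}))), (y, q) ∈ G)
    (x : GaugeConfig 3 L (Matrix.specialUnitaryGroup (Fin 2) ℂ)) (s : ℝ≥0) (e : Edge 3 L) (n : NoiseIdx 2) (i j : Fin 2)
    {J K : ℝ≥0 → {p : ℝ≥0 → (Edge 3 L × NoiseIdx 2 → ℝ) // Continuous p ∧ p 0 = 0} → ℂ}
    (hJ : IsItoIntegralC (fun u p => (latticeLangevinDynamics (fundamentalLatticeRep 2) β).noise
        (matrixConfig (fundamentalRep (Fin 2)) (U x u p)) e n i j)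
      (fun u (p : {p : ℝ≥0 → (Edge 3 L × NoiseIdx 2 → ℝ) // Continuous p ∧ p 0 = 0}) => p.1 u (e, n)) J
      (isFlatBrownian_canonical hW).natFiltration
      (P.map (fun ω => (⟨fun t => W t ω, continuous_path_and_zero hW ω⟩ :
        {p : ℝ≥0 → (Edge 3 L × NoiseIdx 2 → ℝ) // Continuous p ∧ p 0 = 0}))))
    (hK : IsItoIntegralC (fun u p => (latticeLangevinDynamics (fundamentalLatticeRep 2) β).noise
        (matrixConfig (fundamentalRep (Fin 2)) (if u ≤ s then U x u p else U (U x s p) (u - s)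
          ⟨fun v => p.1 (s + v) - p.1 s, continuous_shiftPath_and_zero (isFlatBrownian_canonical hW) s p⟩)) e n i j)
      (fun u (p : {p : ℝ≥0 → (Edge 3 L × NoiseIdx 2 → ℝ) // Continuous p ∧ p 0 = 0}) => p.1 u (e, n)) K
      (isFlatBrownian_canonical hW).natFiltration
      (P.map (fun ω => (⟨fun t => W t ω, continuous_path_and_zero hW ω⟩ :
        {p : ℝ≥0 → (Edge 3 L × NoiseIdx 2 → ℝ) // Continuous p ∧ p 0 = 0})))) :
    ∀ᵐ p ∂(P.map (fun ω => (⟨fun t => W t ω, continuous_path_and_zero hW ω⟩ :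
        {p : ℝ≥0 → (Edge 3 L × NoiseIdx 2 → ℝ) // Continuous p ∧ p 0 = 0}))),
      ∀ u, u ≤ s → K u p = J u p := by
  haveI := secondCountableTopology_su2
  haveI := borelSpace_config L
  haveI : IsProbabilityMeasure (P.map (fun ω => (⟨fun t => W t ω, continuous_path_and_zero hW ω⟩ :
      {p : ℝ≥0 → (Edge 3 L × NoiseIdx 2 → ℝ) // Continuous p ∧ p 0 = 0}))) :=
    Measure.isProbabilityMeasure_map (measurable_pathMap hW).aemeasurable
  have hWc := isFlatBrownian_canonical hW
  have hnc := continuous_noise_entry (L := L) β e n i j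
  -- adaptedness, joint measurability, path continuity of the two integrands
  have hadU : ∀ u, Measurable[hWc.natFiltration u] (U x u) := fun u => measurable_flow_at hW U hprog x u
  have hadX : ∀ u, Measurable[hWc.natFiltration u] (fun p : {p : ℝ≥0 → (Edge 3 L × NoiseIdx 2 → ℝ) //
      Continuous p ∧ p 0 = 0} => if u ≤ s then U x u p else U (U x s p) (u - s)
        ⟨fun v => p.1 (s + v) - p.1 s, continuous_shiftPath_and_zero hWc s p⟩) :=
    fun u => measurable_splice hW U hprog x s u
  have hmU : Measurable fun q : {p : ℝ≥0 → (Edge 3 L × NoiseIdx 2 → ℝ) // Continuous p ∧ p 0 = 0} × ℝ =>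
      U x q.2.toNNReal q.1 :=
    (measurable_uncurry_flow_param hW U hprog).comp ((measurable_const.prodMk measurable_fst).prodMk measurable_snd)
  have hmX : Measurable fun q : {p : ℝ≥0 → (Edge 3 L × NoiseIdx 2 → ℝ) // Continuous p ∧ p 0 = 0} × ℝ =>
      (if q.2.toNNReal ≤ s then U x q.2.toNNReal q.1 else U (U x s q.1) (q.2.toNNReal - s)
        ⟨fun v => q.1.1 (s + v) - q.1.1 s, continuous_shiftPath_and_zero hWc s q.1⟩) :=
    measurable_uncurry_of_prog (Z := fun u (p : {p : ℝ≥0 → (Edge 3 L × NoiseIdx 2 → ℝ) // Continuous p ∧ p 0 = 0}) =>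
        if u ≤ s then U x u p else U (U x s p) (u - s) ⟨fun v => p.1 (s + v) - p.1 s,
          continuous_shiftPath_and_zero hWc s p⟩)
      (fun n => hWc.natFiltration n) (fun n => hWc.natFiltration.le _)
      (fun n => measurable_splice_prog hW U hprog x s n)
  have hcU : ∀ᵐ p ∂(P.map (fun ω => (⟨fun t => W t ω, continuous_path_and_zero hW ω⟩ :
      {p : ℝ≥0 → (Edge 3 L × NoiseIdx 2 → ℝ) // Continuous p ∧ p 0 = 0}))), Continuous fun u => U x u p := by
    filter_upwards [hGae x] with p hp
    exact hGc _ hp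
  have hcX := ae_continuous_splice hW U hU0 hprog hGm hGc hGae x s
  -- real and imaginary parts separately
  have key : ∀ (c : ℂ →L[ℝ] ℝ),
      (∀ {H : ℝ≥0 → {p : ℝ≥0 → (Edge 3 L × NoiseIdx 2 → ℝ) // Continuous p ∧ p 0 = 0} → ℂ}
        {Z : ℝ≥0 → {p : ℝ≥0 → (Edge 3 L × NoiseIdx 2 → ℝ) // Continuous p ∧ p 0 = 0} → ℂ},
        IsItoIntegralC H (fun u (p : {p : ℝ≥0 → (Edge 3 L × NoiseIdx 2 → ℝ) // Continuous p ∧ p 0 = 0}) => p.1 u (e, n))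
          Z hWc.natFiltration (P.map (fun ω => (⟨fun t => W t ω, continuous_path_and_zero hW ω⟩ :
            {p : ℝ≥0 → (Edge 3 L × NoiseIdx 2 → ℝ) // Continuous p ∧ p 0 = 0}))) →
        IsItoIntegral (fun u p => c (H u p)) (fun u (p : {p : ℝ≥0 → (Edge 3 L × NoiseIdx 2 → ℝ) //
          Continuous p ∧ p 0 = 0}) => p.1 u (e, n)) (fun u p => c (Z u p)) hWc.natFiltration
          (P.map (fun ω => (⟨fun t => W t ω, continuous_path_and_zero hW ω⟩ :
            {p : ℝ≥0 → (Edge 3 L × NoiseIdx 2 → ℝ) // Continuous p ∧ p 0 = 0})))) →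
      ∀ᵐ p ∂(P.map (fun ω => (⟨fun t => W t ω, continuous_path_and_zero hW ω⟩ :
        {p : ℝ≥0 → (Edge 3 L × NoiseIdx 2 → ℝ) // Continuous p ∧ p 0 = 0}))), ∀ u, u ≤ s → c (K u p) = c (J u p) := by
    intro c hc
    -- the two real integrands
    set σ : ℝ≥0 → {p : ℝ≥0 → (Edge 3 L × NoiseIdx 2 → ℝ) // Continuous p ∧ p 0 = 0} → ℝ := fun u p =>
      c ((latticeLangevinDynamics (fundamentalLatticeRep 2) β).noise (matrixConfig (fundamentalRep (Fin 2))
        (if u ≤ s then U x u p else U (U x s p) (u - s)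
          ⟨fun v => p.1 (s + v) - p.1 s, continuous_shiftPath_and_zero hWc s p⟩)) e n i j) with hσdef
    set σ1 : ℝ≥0 → {p : ℝ≥0 → (Edge 3 L × NoiseIdx 2 → ℝ) // Continuous p ∧ p 0 = 0} → ℝ := fun u p =>
      c ((latticeLangevinDynamics (fundamentalLatticeRep 2) β).noise (matrixConfig (fundamentalRep (Fin 2))
        (U x u p)) e n i j) with hσ1def
    have hcm : Measurable fun V : GaugeConfig 3 L (Matrix.specialUnitaryGroup (Fin 2) ℂ) =>
        c ((latticeLangevinDynamics (fundamentalLatticeRep 2) β).noise (matrixConfig (fundamentalRep (Fin 2)) V) e n i j) :=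
      (c.continuous.comp hnc).measurable
    have hσa : Adapted hWc.natFiltration σ := fun u => hcm.comp (hadX u)
    have hσ1a : Adapted hWc.natFiltration σ1 := fun u => hcm.comp (hadU u)
    have hσm : Measurable fun q : {p : ℝ≥0 → (Edge 3 L × NoiseIdx 2 → ℝ) // Continuous p ∧ p 0 = 0} × ℝ =>
        σ q.2.toNNReal q.1 := hcm.comp hmX
    have hσ1m : Measurable fun q : {p : ℝ≥0 → (Edge 3 L × NoiseIdx 2 → ℝ) // Continuous p ∧ p 0 = 0} × ℝ =>
        σ1 q.2.toNNReal q.1 := hcm.comp hmU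
    have hσc : ∀ᵐ p ∂(P.map (fun ω => (⟨fun t => W t ω, continuous_path_and_zero hW ω⟩ :
        {p : ℝ≥0 → (Edge 3 L × NoiseIdx 2 → ℝ) // Continuous p ∧ p 0 = 0}))), Continuous (σ · p) := by
      filter_upwards [hcX] with p hp
      exact (c.continuous.comp hnc).comp hp
    have hσ1c : ∀ᵐ p ∂(P.map (fun ω => (⟨fun t => W t ω, continuous_path_and_zero hW ω⟩ :
        {p : ℝ≥0 → (Edge 3 L × NoiseIdx 2 → ℝ) // Continuous p ∧ p 0 = 0}))), Continuous (σ1 · p) := by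
      filter_upwards [hcU] with p hp
      exact (c.continuous.comp hnc).comp hp
    have hucp := tendstoUCP_integral_sample hσa hσm hσc (hc hK)
    have hucp1 := tendstoUCP_integral_sample hσ1a hσ1m hσ1c (hc hJ)
    -- the stopped Riemann sums coincide
    have heq : (fun m u (p : {p : ℝ≥0 → (Edge 3 L × NoiseIdx 2 → ℝ) // Continuous p ∧ p 0 = 0}) =>
        (SimpleProcess.sample σ hσa m).integral (fun u (p : {p : ℝ≥0 → (Edge 3 L × NoiseIdx 2 → ℝ) //
          Continuous p ∧ p 0 = 0}) => p.1 u (e, n)) (min u s) p) =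
        fun m u p => (SimpleProcess.sample σ1 hσ1a m).integral (fun u (p : {p : ℝ≥0 → (Edge 3 L × NoiseIdx 2 → ℝ) //
          Continuous p ∧ p 0 = 0}) => p.1 u (e, n)) (min u s) p := by
      funext m u p
      refine sample_integral_eq_of_eqOn hσa hσ1a _ p (t := s) (fun v hv => ?_) m (min_le_right u s)
      simp only [hσdef, hσ1def, if_pos hv]
    have h1 := tendstoUCP_min hucp s
    have h2 := tendstoUCP_min hucp1 s
    rw [heq] at h1
    filter_upwards [TendstoUCP.ae_eq h1 h2] with p hp
    intro u hu
    have h := hp u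
    simp only [min_eq_left hu] at h
    exact h
  have hre := key Complex.reCLM (fun h => h.1)
  have him := key Complex.imCLM (fun h => h.2)
  filter_upwards [hre, him] with p hpre hpim
  intro u hu
  exact Complex.ext (hpre u hu) (hpim u hu)

end Summit.QuantumFields.YangMills.Theorems.ColdStartUniversality

end
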